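import Literature.AlgebraicGeometry.Frobenioids.PadicKummerThm24iFrobenioidRelBase
import Literature.AlgebraicGeometry.Frobenioids.PadicKummerIsoTransport
import Literature.AlgebraicGeometry.Frobenioids.PadicFrobenioidRelTop
import Literature.AlgebraicGeometry.Frobenioids.PadicFrobenioidPairIsoLevelwise
import Literature.AlgebraicGeometry.Frobenioids.PadicFrobenioidBaseGaloisSystemPushIso
import HarnessLib

/-!
# Frobenioids II, Theorem 2.4 (ii): the `hO`-square — "`Ψ` on `μ_N(A₁) ⊆ O^▷(A₁)` IS the units transport `ψ̄`" (T24ii-J2, P5a)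

Mochizuki, *The geometry of Frobenioids II*, Kyushu J. Math. **62** (2008) 401–460, §2, Theorem 2.4 (ii) p. 20, proof pp. 20–21
[cite: MochizukiFrdII2008, Thm 2.4 (ii) p.21]: "by varying the objects `Aᵢ` and reconstructing the multiplicative group associated
to the field determined by the image of `Aᵢ` … as the groupification of the monoid `O^▷(Aᵢ)` … `Ψ` induces a pair of compatible
isomorphisms `G₁ ⥲ G₂`; `K̄₁^× ⥲ K̄₂^×`".
PROOF-ONLY companion (cell abc-iut, node FrdII:Thm2.4(ii), row «T24ii-J2», piece P5a; seat abc-iut-L1-d1 gen 7).  The Galois-form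
closer `PadicKummer.Def22Context.Iso.exists_thm24ii_ofGalois` takes the binder `hO : ∀ ζ : μ_N(A₁), m₂ (e.muIso N ζ) = ψ̄ (m₁ ζ)`
("`Ψ`, read on `μ_N(A₁) ⊆ O^▷(A₁)` through the charts `μ_N(Aᵢ) ≅ μ_N(K̄ᵢ)`, IS `ψ̄`").  This file PROVES it for the data of the
printed proof: `e` = abc-iut-L1-t7's `isoOfFunctorRelTheta` / `isoOfFunctorRelBasePush` (read on the restricted data `dᵢ.relTop`),
`mᵢ` = the charts' `GaloisChart.muModel`, `ψ̄` = abc-iut-w5-d229's oriented transport `ψn` twisted by `δ⁻¹`,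
`δ := galConjBase₂⁻¹(φ₂ c)`, `c = baseRep` (`PadicKummerIsoGInnerTwist`), from GENERIC binders: the levelwise formula of `ψ̄`
(`hlw`, `hleg₁`, `hleg₂`, `hfac`: the binder shapes of `BaseGaloisSystem.exists_pairIso_fbarUnits_levelwise`), its chart formula
`hψn`, the ONE printed input `hΨB` — "`Ψ_B` is induced by `Ψ` on unit endomorphisms" ([FrdI] Cor. 4.10 / 4.11 (ii) p. 93; the
letter of `PadicFrd.Datum.hpos_of_equivalence`) — and the base-point compatibility `hpt` of the object identification `e_A` with
the straightening `ι_k` ("`e_A ≫ η_A` and `ι_k` have the same point"; for `e_A` assembled from `pushIso` this is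
`BaseGaloisSystem.pt_pushIso_hom_app_rQ`, §1c).  `hpt` is NECESSARY: the square fails for `e_A` composed with a non-trivial
automorphism of `θ_*((A₁)_D)` (it changes `δ`, not the left side).  No definitions; nothing here bears on [IUTchIII] Cor. 3.12.
-/

noncomputable section
namespace Literature.AlgebraicGeometry.Frobenioids

open CategoryTheory CategoryTheory.Limits Opposite Function Field IntermediateField
open Literature.NumberTheory.GaloisRepresentations
open Literature.AnabelianGeometry.SemiGraphs QuasiTemperoid BaseGaloisSystem

/-! ### §1 Field maps of the genuine base functor between two objects, through base-point representatives -/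
namespace PadicFrd.RelGal
variable {p : ℕ} [Fact p.Prime] {P : Type} [Group P] [TopologicalSpace P] (φ₀ : P →* GalFbar ℚ_[p]) (hφ₀ : IsOpenHom φ₀)

/-- **The field map of `h : Π/U → Π/U'` under the genuine base functor `φ_* ⋙ (bridge) ⋙ (Galois correspondence)`**, read
through representatives `x`, `x'` of the chosen base points of `φ_*(Π/U)`, `φ_*(Π/U')` and `π` with `h(1·U) = π·U'`:
`a ↦ (x · φ₀(π) · x'⁻¹) · a` (generalises `fieldMap_push_apply`, the case `U = U'`). [cite: MochizukiFrdII2008, Ex 1.3 (iii) pp.11-12] -/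
theorem fieldMap_push_apply_of_reps {X Y : CosetCat P} (h : X ⟶ Y) (π : P) (hπ : (π : Y.carrier) = CosetCat.pt h)
    (x : GalFbar ℚ_[p])
    (hx : (x : ((CosetCat.push φ₀ hφ₀.isOpenMap).obj X).carrier) =
      basePt ((CosetCat.toConnected (isTempered_galFbar ℚ_[p])).obj ((CosetCat.push φ₀ hφ₀.isOpenMap).obj X)))
    (x' : GalFbar ℚ_[p])
    (hx' : (x' : ((CosetCat.push φ₀ hφ₀.isOpenMap).obj Y).carrier) =
      basePt ((CosetCat.toConnected (isTempered_galFbar ℚ_[p])).obj ((CosetCat.push φ₀ hφ₀.isOpenMap).obj Y)))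
    (a : fixFld ℚ_[p] ((CosetCat.toConnected (isTempered_galFbar ℚ_[p])).obj ((CosetCat.push φ₀ hφ₀.isOpenMap).obj Y))) :
    (fieldMap ((CosetCat.toConnected (isTempered_galFbar ℚ_[p])).map ((CosetCat.push φ₀ hφ₀.isOpenMap).map h)) a :
        Fbar ℚ_[p]) = (x * φ₀ π * x'⁻¹) a := by
  have hc : ((φ₀ π : GalFbar ℚ_[p]) : ((CosetCat.push φ₀ hφ₀.isOpenMap).obj Y).carrier) =
      CosetCat.pt ((CosetCat.push φ₀ hφ₀.isOpenMap).map h) := by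
    rw [CosetCat.pt_push_map, ← hπ, CosetCat.pushQuot_coe]
  apply fieldMap_apply_of_ρ_eq
  rw [← hx, ← hx', ptMap_toConnected_map_mk p _ hc]
  change (x * φ₀ π * x'⁻¹) • (x' : ((CosetCat.push φ₀ hφ₀.isOpenMap).obj Y).carrier) = _
  rw [MulAction.Quotient.smul_coe, smul_eq_mul, inv_mul_cancel_right]

/-- Two representatives of the chosen base point of `φ_*(Π/U)` act identically after inversion on the field
`ℚ̄_p^{Stab}` of that object shifted by either: `x⁻¹·a = y⁻¹·a` for `a ∈ x·K_U` (`x⁻¹y ∈ φ₀(U)` fixes `K_U = ℚ̄_p^{φ₀(U)}`).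
[cite: MochizukiFrdII2008, Rmk 2.2.1 p.18] -/
theorem inv_apply_eq_of_coe_eq {X : CosetCat P} (x y : GalFbar ℚ_[p])
    (hxy : (x : ((CosetCat.push φ₀ hφ₀.isOpenMap).obj X).carrier) = (y : ((CosetCat.push φ₀ hφ₀.isOpenMap).obj X).carrier))
    (hx : (x : ((CosetCat.push φ₀ hφ₀.isOpenMap).obj X).carrier) =
      basePt ((CosetCat.toConnected (isTempered_galFbar ℚ_[p])).obj ((CosetCat.push φ₀ hφ₀.isOpenMap).obj X)))
    {a : Fbar ℚ_[p]}
    (ha : a ∈ fixFld ℚ_[p] ((CosetCat.toConnected (isTempered_galFbar ℚ_[p])).obj ((CosetCat.push φ₀ hφ₀.isOpenMap).obj X))) :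
    x⁻¹ a = y⁻¹ a := by
  have hw : x⁻¹ * y ∈ ((CosetCat.push φ₀ hφ₀.isOpenMap).obj X).sg := QuotientGroup.eq.mp hxy
  have h1 := (QuasiTemperoid.mem_fixFld_toConnected_iff p _ hx a).mp ha _ (inv_mem hw)
  have h2 : x⁻¹ ((x * (x⁻¹ * y)⁻¹ * x⁻¹) a) = x⁻¹ a := by rw [h1]
  rw [← AlgEquiv.mul_apply, show x⁻¹ * (x * (x⁻¹ * y)⁻¹ * x⁻¹) = y⁻¹ * x * x⁻¹ by group,
    mul_inv_cancel_right] at h2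
  exact h2.symm

end PadicFrd.RelGal

/-! ### §1b The chart `μ_n(A) ≅ μ_n(K̄)` and the base maps of a datum over the genuine base, cast-free on `ℚ̄_p` -/

namespace PadicFrd.Datum
open PadicFrd.RelGal PadicFrd.Datum.GaloisChart
variable {p : ℕ} [Fact p.Prime] {G : Type} [Group G] [TopologicalSpace G] (φ₀ : G →* GalFbar ℚ_[p]) (hφ₀ : IsOpenHom φ₀)
  {d : Datum (CosetCat G) p}
  (hd : d.base = CosetCat.push φ₀ hφ₀.isOpenMap ⋙ CosetCat.toConnected (isTempered_galFbar ℚ_[p]) ⋙ galoisPadicFields p)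

/-- **The base maps of a datum over the genuine §2 base ARE the Galois-correspondence field maps**, read in `ℚ̄_p` through the
identification `hd` (the `eqToHom` reading of `BaseGaloisSystem.exists_pairIso_fbarUnits_levelwise`).
[cite: MochizukiFrdII2008, Ex 1.3 (iii) pp.11-12] -/
theorem coe_cast_base_map_alg {X Y : CosetCat G} (h : X ⟶ Y) (y : d.fld Y) :
    ((show ↥(fixFld ℚ_[p] ((CosetCat.toConnected (isTempered_galFbar ℚ_[p])).obj ((CosetCat.push φ₀ hφ₀.isOpenMap).obj X))) from
        ((eqToHom (congrArg (fun b : CosetCat G ⥤ PadicFrd.PadicFld.{0} p => b.obj X) hd).symm).alg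
          ((d.base.map h).alg y))) : Fbar ℚ_[p]) =
      fieldMap ((CosetCat.toConnected (isTempered_galFbar ℚ_[p])).map ((CosetCat.push φ₀ hφ₀.isOpenMap).map h))
        (show ↥(fixFld ℚ_[p] ((CosetCat.toConnected (isTempered_galFbar ℚ_[p])).obj ((CosetCat.push φ₀ hφ₀.isOpenMap).obj Y))) from
          ((eqToHom (congrArg (fun b : CosetCat G ⥤ PadicFrd.PadicFld.{0} p => b.obj Y) hd).symm).alg y)) := by
  obtain ⟨base, hloc, hc, he, Φ, j, hj, hmono, B, toB0, divB, sq, cart, nz⟩ := d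
  cases hd
  rfl

/-- **The chart `O^▷(A♭) ↪ K̄` of `galoisChartRel` over the restricted datum `d♭`, read in `ℚ̄_p`**: `ι(f) = g_A⁻¹ · u_f|_{K^×}`,
`g_A` the chart's base-point representative (`objRep`), `u_f` read through `hd`. [cite: MochizukiFrdII2008, Rmk 2.2.1 p.18] -/
theorem closureEquiv_toClosure_galoisChartRel (A : d.frobenioid) (hA : (d.toRelTopFrob.obj A).base.obj.sg.toSubgroup.Normal)
    (g : ObjMonoid d.relTop (d.toRelTopFrob.obj A)) :
    closureEquiv p φ₀ hφ₀
        ((galoisChartRel φ₀ hφ₀ d.relTop (d.relTop_base_eq φ₀ hφ₀ hd) (d.toRelTopFrob.obj A) hA).toClosure g) =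
      (objRep φ₀ hφ₀ d.relTop (d.toRelTopFrob.obj A))⁻¹
        ((show ↥(fixFld ℚ_[p] ((CosetCat.toConnected (isTempered_galFbar ℚ_[p])).obj ((CosetCat.push φ₀ hφ₀.isOpenMap).obj A.base)))
            from ((eqToHom (congrArg (fun b : CosetCat G ⥤ PadicFrd.PadicFld.{0} p => b.obj A.base) hd).symm).alg
              (@Units.val (d.fld A.base) _ ((d.toB0.app (op A.base)).hom (ModelFrobenioid.unit (d.ofRelTopFrob.map g.hom)))))) : Fbar ℚ_[p]) := by
  obtain ⟨base, hloc, hc, he, Φ, j, hj, hmono, B, toB0, divB, sq, cart, nz⟩ := d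
  cases hd
  rw [toClosure_apply]
  exact (closureEquiv p φ₀ hφ₀).apply_symm_apply _

end PadicFrd.Datum

/-! ### §1c The point of abc-iut-L1-t7's `pushIso` ("`Ψ_Base = φ_*`") at a level object `Π₁/N_k` -/

namespace BaseGaloisSystem

section PushIsoLevel

universe u

open Topology Filter

variable {G : Type u} [Group G] [TopologicalSpace G] (hG : IsTempered G) (H : OpenSubgroup G)
  {G₂ : Type u} [Group G₂] [TopologicalSpace G₂] (hG₂ : IsTempered G₂) (H₂ : OpenSubgroup G₂)
  (E : RelCosetCat H ≌ RelCosetCat H₂)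
  (N : ℕ → OpenNormalSubgroup G) (hN : Antitone N) (hNH : ∀ k, (N k).toOpenSubgroup ≤ H)
  (hNb : ∀ U ∈ 𝓝 (1 : G), ∃ k, (N k : Set G) ⊆ U)
  (N₂ : ℕ → OpenNormalSubgroup G₂) (hN₂ : Antitone N₂) (hNH₂ : ∀ k, (N₂ k).toOpenSubgroup ≤ H₂)
  (hN₂b : ∀ U ∈ 𝓝 (1 : G₂), ∃ k, (N₂ k : Set G₂) ⊆ U)
  (ι : relCosetSystem H N hN hNH ⋙ E.functor.op ≅ relCosetSystem H₂ N₂ hN₂ hNH₂) (φ : G ≃* G₂)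
  (hφ : ∀ g : G, toAutRelCosetMulEquiv H₂ N₂ hN₂ hNH₂ hG₂ hN₂b (φ g) =
    ι.conjAut ((Equivalence.congrRight (E := ℕ) E.op).functor.mapIso (toAutRelCosetMulEquiv H N hN hNH hG hNb g)))
  (hφo : IsOpenMap φ.toMonoidHom)

/-- **At the level object `Π₁/N_k` the component of `pushIso` ("`Ψ_Base = φ_*` 1-compatibly", abc-iut-L1-t7 gen 6) has the
same point as the straightening `ι_k : Π₂/N₂,k ⥲ E(Π₁/N_k)`** — the base point `y_{Π₁/N_k}` computed at level `k` itself
(`basePt_eq`, the projection `Π₁/N_k ↠ Π₁/N_k` being the identity).  This is the shape of the base-point compatibility `hpt` of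
`PadicKummer.Def22Context.hO_of_levelwise` for `εF` assembled from `pushIso`. [cite: MochizukiFrdII2008, Thm 2.4 (i) p.19] -/
theorem pt_pushIso_hom_app_rQ (k : ℕ) :
    CosetCat.pt ((pushIso hG H hG₂ H₂ E N hN hNH hNb N₂ hN₂ hNH₂ hN₂b ι φ hφ hφo).hom.app (rQ H (N k) (hNH k))) =
      CosetCat.pt (ι.hom.app k).unop.hom := by
  have h1 : (ObjectProperty.homMk (cprojTo (N k) (cQ (N k)) le_rfl) : rQ H (N k) (hNH k) ⟶ rQ H (N k) (hNH k)) = 𝟙 _ :=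
    ObjectProperty.hom_ext _ (CosetCat.hom_ext (by rw [ObjectProperty.homMk_hom, pt_cprojTo]; rfl))
  change CosetCat.pt (pushHomApp hG H hG₂ H₂ E N hN hNH hNb N₂ hN₂ hNH₂ hN₂b ι φ hφ hφo (rQ H (N k) (hNH k))) = _
  rw [pt_pushHomApp, basePt_eq H H₂ E N hN hNH hNb N₂ hN₂ hNH₂ ι (rQ H (N k) (hNH k)) k le_rfl, cmp, h1,
    CategoryTheory.Functor.map_id, Category.comp_id]
  rfl

end PushIsoLevel

end BaseGaloisSystem

/-! ### §2 The `hO`-square -/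

namespace PadicKummer.Def22Context

open Kummer PadicFrd PadicFrd.Datum PadicFrd.Datum.GaloisChart PadicFrd.RelGal

variable {p₁ p₂ : ℕ} [Fact p₁.Prime] [Fact p₂.Prime]
  {G₁ : Type} [Group G₁] [TopologicalSpace G₁] (φ₁ : G₁ →* GalFbar ℚ_[p₁]) (hφ₁ : IsOpenHom φ₁)
  {G₂ : Type} [Group G₂] [TopologicalSpace G₂] (φ₂ : G₂ →* GalFbar ℚ_[p₂]) (hφ₂ : IsOpenHom φ₂)
  {d₁ : PadicFrd.Datum (CosetCat G₁) p₁} {d₂ : PadicFrd.Datum (CosetCat G₂) p₂}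
  (hd₁ : d₁.base = CosetCat.push φ₁ hφ₁.isOpenMap ⋙ CosetCat.toConnected (isTempered_galFbar ℚ_[p₁]) ⋙ galoisPadicFields p₁)
  (hd₂ : d₂.base = CosetCat.push φ₂ hφ₂.isOpenMap ⋙ CosetCat.toConnected (isTempered_galFbar ℚ_[p₂]) ⋙ galoisPadicFields p₂)
  (Ψ : d₁.frobenioid ≌ d₂.frobenioid)
  -- "`Ψ` induces `Ψ_Base`" (`E`, `η`) and "`Ψ_B` induced by `Ψ` on unit endomorphisms" (`ΨB`, `hΨB`: [FrdI] Cor. 4.10/4.11 (ii))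
  (E : CosetCat G₁ ⥤ CosetCat G₂)
  (η : Ψ.functor ⋙ ModelFrobenioid.baseFunctor d₂.Φ d₂.B d₂.divB ≅ ModelFrobenioid.baseFunctor d₁.Φ d₁.B d₁.divB ⋙ E)
  (ΨB : d₁.B ≅ E.op ⋙ d₂.B)
  (hΨB : ∀ (A : d₁.frobenioid) (f : A ⟶ A), f ∈ PreFrobenioid.endSubmonoid d₁.structureFunctor A →
    ModelFrobenioid.unit (Ψ.functor.map f) = (d₂.B.map (η.hom.app A).op).hom (ΨB.hom.app (op A.base) (ModelFrobenioid.unit f)))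
  (N : ℕ → OpenNormalSubgroup G₁) (hN : Antitone N) (N₂ : ℕ → OpenNormalSubgroup G₂) (hN₂ : Antitone N₂) (k : ℕ)
  [HasColimitsOfShape ℕ CommMonCat.{0}]
  -- the straightening and the levelwise pair (binder shapes of `BaseGaloisSystem.exists_pairIso_fbarUnits_levelwise`)
  (ι : cosetSystem N hN ⋙ E.op ≅ cosetSystem N₂ hN₂)
  (ec : colimit (cosetSystem N hN ⋙ PadicFrd.bZeroOn d₁.base) ≅ colimit (cosetSystem N₂ hN₂ ⋙ PadicFrd.bZeroOn d₂.base))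
  (x₁ : ℕ → GalFbar ℚ_[p₁])
  (hx₁ : ∀ k, (x₁ k : ((CosetCat.push φ₁ hφ₁.isOpenMap).obj (cQ (N k))).carrier) =
    (basePt ((CosetCat.toConnected (isTempered_galFbar ℚ_[p₁])).obj ((CosetCat.push φ₁ hφ₁.isOpenMap).obj (cQ (N k)))) :
      ((CosetCat.push φ₁ hφ₁.isOpenMap).obj (cQ (N k))).carrier))
  (x₂ : ℕ → GalFbar ℚ_[p₂])
  (hx₂ : ∀ k, (x₂ k : ((CosetCat.push φ₂ hφ₂.isOpenMap).obj (cQ (N₂ k))).carrier) =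
    (basePt ((CosetCat.toConnected (isTempered_galFbar ℚ_[p₂])).obj ((CosetCat.push φ₂ hφ₂.isOpenMap).obj (cQ (N₂ k)))) :
      ((CosetCat.push φ₂ hφ₂.isOpenMap).obj (cQ (N₂ k))).carrier))
  (ι₁ : colimit (cosetSystem N hN ⋙ PadicFrd.bZeroOn d₁.base) ≅ CommMonCat.of (Fbar ℚ_[p₁])ˣ)
  (ι₂ : colimit (cosetSystem N₂ hN₂ ⋙ PadicFrd.bZeroOn d₂.base) ≅ CommMonCat.of (Fbar ℚ_[p₂])ˣ)
  (ψbar : (Fbar ℚ_[p₁])ˣ ≃* (Fbar ℚ_[p₂])ˣ)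
  (hlw : ∀ (k : ℕ) (b : d₁.B.obj (op (cQ (N k)))),
    ec.hom (colimit.ι (cosetSystem N hN ⋙ PadicFrd.bZeroOn d₁.base) k (d₁.toB0.app (op (cQ (N k))) b)) =
      colimit.ι (cosetSystem N₂ hN₂ ⋙ PadicFrd.bZeroOn d₂.base) k
        ((PadicFrd.bZeroOn d₂.base).map (ι.hom.app k)
          (d₂.toB0.app (op (E.obj (cQ (N k)))) (ΨB.hom.app (op (cQ (N k))) b))))
  (hleg₁ : ∀ (k : ℕ) (u : (cosetSystem N hN ⋙ PadicFrd.bZeroOn d₁.base).obj k),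
    ((ι₁.hom (colimit.ι (cosetSystem N hN ⋙ PadicFrd.bZeroOn d₁.base) k u) : (Fbar ℚ_[p₁])ˣ) : Fbar ℚ_[p₁]) =
      (x₁ k)⁻¹ ((show ↥(fixFld ℚ_[p₁] ((CosetCat.toConnected (isTempered_galFbar ℚ_[p₁])).obj
          ((CosetCat.push φ₁ hφ₁.isOpenMap).obj (cQ (N k))))) from
        ((eqToHom (congrArg (fun b : CosetCat G₁ ⥤ PadicFrd.PadicFld.{0} p₁ => b.obj (cQ (N k))) hd₁).symm).alg
          (show ((cosetSystem N hN ⋙ PadicFrd.bZeroOn d₁.base).obj k) from u).val)) : Fbar ℚ_[p₁]))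
  (hleg₂ : ∀ (k : ℕ) (u : (cosetSystem N₂ hN₂ ⋙ PadicFrd.bZeroOn d₂.base).obj k),
    ((ι₂.hom (colimit.ι (cosetSystem N₂ hN₂ ⋙ PadicFrd.bZeroOn d₂.base) k u) : (Fbar ℚ_[p₂])ˣ) : Fbar ℚ_[p₂]) =
      (x₂ k)⁻¹ ((show ↥(fixFld ℚ_[p₂] ((CosetCat.toConnected (isTempered_galFbar ℚ_[p₂])).obj
          ((CosetCat.push φ₂ hφ₂.isOpenMap).obj (cQ (N₂ k))))) from
        ((eqToHom (congrArg (fun b : CosetCat G₂ ⥤ PadicFrd.PadicFld.{0} p₂ => b.obj (cQ (N₂ k))) hd₂).symm).alg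
          (show ((cosetSystem N₂ hN₂ ⋙ PadicFrd.bZeroOn d₂.base).obj k) from u).val)) : Fbar ℚ_[p₂]))
  (hfac : ∀ z, ψbar (ι₁.hom z) = ι₂.hom (ec.hom z))
  -- the chart reading of `ψ̄` (shape of `BaseGaloisSystem.exists_pairIso_absAnabChart_unitsTransport`)
  (ψn : (AlgebraicClosure (baseFld p₁ φ₁ hφ₁))ˣ ≃* (AlgebraicClosure (baseFld p₂ φ₂ hφ₂))ˣ)
  (hψn : ∀ y : (AlgebraicClosure (baseFld p₁ φ₁ hφ₁))ˣ,
    ((ψn y : (AlgebraicClosure (baseFld p₂ φ₂ hφ₂))ˣ) : AlgebraicClosure (baseFld p₂ φ₂ hφ₂)) =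
      (closureEquiv p₂ φ₂ hφ₂).symm
        ((ψbar (Units.map ((closureEquiv p₁ φ₁ hφ₁ :
          AlgebraicClosure (baseFld p₁ φ₁ hφ₁) ≃ₐ[baseFld p₁ φ₁ hφ₁] Fbar ℚ_[p₁]) :
            AlgebraicClosure (baseFld p₁ φ₁ hφ₁) →* Fbar ℚ_[p₁]) y) : (Fbar ℚ_[p₂])ˣ) : Fbar ℚ_[p₂]))
  -- the object `A₁ = (Π₁/N_k, α)` and the structural data of `isoOfFunctorRelTheta` at `A₁♭`
  (cls : Algebra.GrothendieckGroup (d₁.Φ.obj (op (cQ (N k)))))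
  (hA₁ : (d₁.toRelTopFrob.obj ⟨cQ (N k), cls⟩).base.obj.sg.toSubgroup.Normal)
  (hA₂ : ((relTopEquivalence Ψ).functor.obj (d₁.toRelTopFrob.obj ⟨cQ (N k), cls⟩)).base.obj.sg.toSubgroup.Normal)
  (hO : ∀ f : d₁.toRelTopFrob.obj ⟨cQ (N k), cls⟩ ⟶ d₁.toRelTopFrob.obj ⟨cQ (N k), cls⟩,
    f ∈ PreFrobenioid.endSubmonoid d₁.relTop.structureFunctor (d₁.toRelTopFrob.obj ⟨cQ (N k), cls⟩) ↔
      (relTopEquivalence Ψ).functor.map f ∈ PreFrobenioid.endSubmonoid d₂.relTop.structureFunctor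
        ((relTopEquivalence Ψ).functor.obj (d₁.toRelTopFrob.obj ⟨cQ (N k), cls⟩)))
  (θ : G₁ →* G₂) (hθc : Continuous θ) (hθo : IsOpenMap θ) (hθs : Surjective θ)
  (hkerθ : ∀ x : G₁, φ₁ x = 1 ↔ φ₂ (θ x) = 1)
  (eb : (CosetCat.push θ hθo).obj (d₁.toRelTopFrob.obj ⟨cQ (N k), cls⟩).base.obj ≅
    ((relTopEquivalence Ψ).functor.obj (d₁.toRelTopFrob.obj ⟨cQ (N k), cls⟩)).base.obj)
  (compat : ∀ α : Aut (d₁.toRelTopFrob.obj ⟨cQ (N k), cls⟩),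
    (ModelFrobenioid.baseMap ((relTopEquivalence Ψ).functor.mapIso α).inv).hom =
      eb.inv ≫ (CosetCat.push θ hθo).map (ModelFrobenioid.baseMap α.inv).hom ≫ eb.hom)
  {H₁ : Subgroup (absoluteGaloisGroup (baseFld p₁ φ₁ hφ₁))} [H₁.Normal]
  {hH₁ : IsOpen (H₁ : Set (absoluteGaloisGroup (baseFld p₁ φ₁ hφ₁)))}
  {H₂ : Subgroup (absoluteGaloisGroup (baseFld p₂ φ₂ hφ₂))} [H₂.Normal]
  {hH₂ : IsOpen (H₂ : Set (absoluteGaloisGroup (baseFld p₂ φ₂ hφ₂)))}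
  (map_H : H₁.map (isoGOfTheta φ₁ hφ₁ φ₂ hφ₂ (relTopEquivalence Ψ).functor θ hθc hθo hθs hkerθ eb).toMulEquiv.toMonoidHom = H₂)
  (n : ℕ) [NeZero n]
  (hμ₁ : ∀ ζ : rootsOfUnity n (AlgebraicClosure (baseFld p₁ φ₁ hφ₁)),
    ((ζ : (AlgebraicClosure (baseFld p₁ φ₁ hφ₁))ˣ) : AlgebraicClosure (baseFld p₁ φ₁ hφ₁)) ∈
      objL φ₁ hφ₁ d₁.relTop (d₁.toRelTopFrob.obj ⟨cQ (N k), cls⟩))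
  (hμ₂ : ∀ ζ : rootsOfUnity n (AlgebraicClosure (baseFld p₂ φ₂ hφ₂)),
    ((ζ : (AlgebraicClosure (baseFld p₂ φ₂ hφ₂))ˣ) : AlgebraicClosure (baseFld p₂ φ₂ hφ₂)) ∈
      objL φ₂ hφ₂ d₂.relTop ((relTopEquivalence Ψ).functor.obj (d₁.toRelTopFrob.obj ⟨cQ (N k), cls⟩)))

include hΨB hN₂ x₁ hx₁ x₂ hx₂ ι₁ ι₂ hlw hleg₁ hleg₂ hfac hψn in
/-- **[FrdII] Thm. 2.4 (ii), the `hO`-square.**  For the object `A₁ = (Π₁/N_k, α)` of the `p₁`-adic Frobenioid `C₁` and the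
context isomorphism `e := isoOfFunctorRelTheta …` induced by the equivalence `Ψ` (read on the restricted data `dᵢ.relTop`),
the identifications `mᵢ : μ_n(Aᵢ) ⥲ μ_n(K̄ᵢ)` of the charts (`GaloisChart.muModel`) and the units transport of abc-iut-L1-t7's
representative — `ψ̄′ := δ⁻¹ • ψn`, `δ = galConjBase₂⁻¹(φ₂ c)`, `c = baseRep` — satisfy
`m₂ (e.muIso n ζ) = ψ̄′ (m₁ ζ)` for every `ζ ∈ μ_n(A₁)`: "`Ψ`, read on `μ_n(A₁) ⊆ O^▷(A₁)`, IS the transport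
`K̄₁^× ⥲ K̄₂^×` induced by `Ψ`" (the binder `hO` of `Def22Context.Iso.exists_thm24ii_ofGalois`), GIVEN: `Ψ_B` is
induced by `Ψ` on `O^▷(−)` (`hΨB`, [FrdI] Cor. 4.10 / 4.11 (ii)), the levelwise formula of `ψ̄` (`hlw`, `hleg₁`, `hleg₂`,
`hfac`), its chart reading (`hψn`), and the base-point compatibility `hpt` of `e_{A₁}` with the straightening `ι_k`.
[cite: MochizukiFrdII2008, Thm 2.4 (ii) p.21] -/
theorem hO_of_levelwise
    (hpt : CosetCat.pt (eb.hom ≫ η.hom.app ⟨cQ (N k), cls⟩) = CosetCat.pt (ι.hom.app k).unop) :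
    haveI := normal_objL φ₁ hφ₁ d₁.relTop (d₁.toRelTopFrob.obj ⟨cQ (N k), cls⟩) hA₁
    haveI := normal_objL φ₂ hφ₂ d₂.relTop ((relTopEquivalence Ψ).functor.obj (d₁.toRelTopFrob.obj ⟨cQ (N k), cls⟩)) hA₂
    letI := (galoisChartRel φ₁ hφ₁ d₁.relTop (d₁.relTop_base_eq φ₁ hφ₁ hd₁) (d₁.toRelTopFrob.obj ⟨cQ (N k), cls⟩) hA₁).galAction
    letI := (galoisChartRel φ₂ hφ₂ d₂.relTop (d₂.relTop_base_eq φ₂ hφ₂ hd₂)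
      ((relTopEquivalence Ψ).functor.obj (d₁.toRelTopFrob.obj ⟨cQ (N k), cls⟩)) hA₂).galAction
    ∀ ζ : Kummer.Mu n (ObjMonoid d₁.relTop (d₁.toRelTopFrob.obj ⟨cQ (N k), cls⟩)),
      ((((galoisChartRel φ₂ hφ₂ d₂.relTop (d₂.relTop_base_eq φ₂ hφ₂ hd₂)
          ((relTopEquivalence Ψ).functor.obj (d₁.toRelTopFrob.obj ⟨cQ (N k), cls⟩)) hA₂).muModel n hμ₂).toMulEquiv
        ((isoOfFunctorRelTheta (hH₁ := hH₁) (hH₂ := hH₂) (d₁.relTop_base_eq φ₁ hφ₁ hd₁) (d₂.relTop_base_eq φ₂ hφ₂ hd₂)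
          (relTopEquivalence Ψ).functor hA₁ hA₂ hO θ hθc hθo hθs hkerθ eb compat map_H).muIso n ζ) :
          rootsOfUnity n (AlgebraicClosure (baseFld p₂ φ₂ hφ₂))) : (AlgebraicClosure (baseFld p₂ φ₂ hφ₂))ˣ) =
      (ψn.trans (MulDistribMulAction.toMulEquiv ((AlgebraicClosure (baseFld p₂ φ₂ hφ₂))ˣ)
        (((galConjBase p₂ φ₂ hφ₂).symm (toIm φ₂ hφ₂
          (baseRep (relTopEquivalence Ψ).functor θ hθo eb)))⁻¹)))
        ((((galoisChartRel φ₁ hφ₁ d₁.relTop (d₁.relTop_base_eq φ₁ hφ₁ hd₁) (d₁.toRelTopFrob.obj ⟨cQ (N k), cls⟩)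
            hA₁).muModel n hμ₁).toMulEquiv ζ : rootsOfUnity n (AlgebraicClosure (baseFld p₁ φ₁ hφ₁))) :
          (AlgebraicClosure (baseFld p₁ φ₁ hφ₁))ˣ) := by
  intro ζ
  haveI := normal_objL φ₁ hφ₁ d₁.relTop (d₁.toRelTopFrob.obj ⟨cQ (N k), cls⟩) hA₁
  haveI := normal_objL φ₂ hφ₂ d₂.relTop ((relTopEquivalence Ψ).functor.obj (d₁.toRelTopFrob.obj ⟨cQ (N k), cls⟩)) hA₂
  letI := (galoisChartRel φ₁ hφ₁ d₁.relTop (d₁.relTop_base_eq φ₁ hφ₁ hd₁) (d₁.toRelTopFrob.obj ⟨cQ (N k), cls⟩)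
    hA₁).galAction
  letI := (galoisChartRel φ₂ hφ₂ d₂.relTop (d₂.relTop_base_eq φ₂ hφ₂ hd₂)
    ((relTopEquivalence Ψ).functor.obj (d₁.toRelTopFrob.obj ⟨cQ (N k), cls⟩)) hA₂).galAction
  -- the endomorphism `f ∈ O^▷(A₁)` underlying `ζ` (`O^▷(A₁♭) = O^▷(A₁)`), `A₁ = (Π₁/N_k, α)`
  have hf : d₁.ofRelTopFrob.map (ζ.val : ObjMonoid d₁.relTop (d₁.toRelTopFrob.obj ⟨cQ (N k), cls⟩)).hom ∈
      PreFrobenioid.endSubmonoid d₁.structureFunctor ⟨cQ (N k), cls⟩ :=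
    (d₁.toRelTopFrob_map_mem_endSubmonoid_iff ⟨cQ (N k), cls⟩ _).mp
      (ζ.val : ObjMonoid d₁.relTop (d₁.toRelTopFrob.obj ⟨cQ (N k), cls⟩)).hom_mem
  -- representatives: `π_ι` of the point of `ι_k`, `x_Z` of the base point of `φ₂_*(E(Π₁/N_k))`
  obtain ⟨πι, hπι⟩ := QuotientGroup.mk_surjective (CosetCat.pt (ι.hom.app k).unop)
  obtain ⟨xZ, hxZ⟩ := QuotientGroup.mk_surjective
    (basePt ((CosetCat.toConnected (isTempered_galFbar ℚ_[p₂])).obj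
      ((CosetCat.push φ₂ hφ₂.isOpenMap).obj (E.obj (cQ (N k))))) :
        ((CosetCat.push φ₂ hφ₂.isOpenMap).obj (E.obj (cQ (N k)))).carrier)
  have hπη : (((baseRep (relTopEquivalence Ψ).functor θ hθo eb)⁻¹ * πι : G₂) : (E.obj (cQ (N k))).carrier) =
      CosetCat.pt (η.hom.app ⟨cQ (N k), cls⟩) := by
    have h := hpt
    rw [CosetCat.pt_comp, ← baseRep_spec (relTopEquivalence Ψ).functor θ hθo eb, CosetCat.toFun_coe, ← hπι] at h
    exact (eq_inv_smul_iff.mpr h).symm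
  -- LHS: chart of `Ψ A₁` via `hΨB`, `B → B₀` naturality, base map of `η` = field map `g_{A₂} φ₂(c⁻¹ π_ι) x_Z⁻¹`
  have h1 := closureEquiv_toClosure_galoisChartRel φ₂ hφ₂ hd₂ (Ψ.functor.obj ⟨cQ (N k), cls⟩) hA₂
    (Units.val ((isoOfFunctorRelTheta (hH₁ := hH₁) (hH₂ := hH₂) (d₁.relTop_base_eq φ₁ hφ₁ hd₁) (d₂.relTop_base_eq φ₂ hφ₂ hd₂)
      (relTopEquivalence Ψ).functor hA₁ hA₂ hO θ hθc hθo hθs hkerθ eb compat map_H).muIso n ζ).val)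
  have h2 : ModelFrobenioid.unit (d₂.ofRelTopFrob.map
      (ObjMonoid.hom (A := d₂.toRelTopFrob.obj (Ψ.functor.obj ⟨cQ (N k), cls⟩))
        (Units.val ((isoOfFunctorRelTheta (hH₁ := hH₁) (hH₂ := hH₂) (d₁.relTop_base_eq φ₁ hφ₁ hd₁)
          (d₂.relTop_base_eq φ₂ hφ₂ hd₂) (relTopEquivalence Ψ).functor hA₁ hA₂ hO θ hθc hθo hθs hkerθ eb compat
          map_H).muIso n ζ).val))) =
      (d₂.B.map (η.hom.app ⟨cQ (N k), cls⟩).op).hom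
        (ΨB.hom.app (op (cQ (N k))) (ModelFrobenioid.unit
          (d₁.ofRelTopFrob.map (ζ.val : ObjMonoid d₁.relTop (d₁.toRelTopFrob.obj ⟨cQ (N k), cls⟩)).hom))) :=
    hΨB _ _ hf
  rw [h2] at h1
  erw [d₂.toB0_naturality_apply ((η.hom.app ⟨cQ (N k), cls⟩).op)] at h1
  have h4 := (coe_cast_base_map_alg φ₂ hφ₂ hd₂ (η.hom.app ⟨cQ (N k), cls⟩)
    (@Units.val (d₂.fld (E.obj (cQ (N k)))) _ (d₂.toB0.app (op (E.obj (cQ (N k))))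
      (ΨB.hom.app (op (cQ (N k))) (ModelFrobenioid.unit
        (d₁.ofRelTopFrob.map (ζ.val : ObjMonoid d₁.relTop (d₁.toRelTopFrob.obj ⟨cQ (N k), cls⟩)).hom)))))).trans
    (fieldMap_push_apply_of_reps φ₂ hφ₂ (η.hom.app ⟨cQ (N k), cls⟩) _ hπη
      (objRep φ₂ hφ₂ d₂.relTop (d₂.toRelTopFrob.obj (Ψ.functor.obj ⟨cQ (N k), cls⟩)))
      (objRep_spec φ₂ hφ₂ d₂.relTop (d₂.toRelTopFrob.obj (Ψ.functor.obj ⟨cQ (N k), cls⟩))) xZ hxZ _)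
  have hL := h1.trans (congrArg
    (fun z => (objRep φ₂ hφ₂ d₂.relTop (d₂.toRelTopFrob.obj (Ψ.functor.obj ⟨cQ (N k), cls⟩)))⁻¹ z) h4)
  have hV : Units.map ((closureEquiv p₁ φ₁ hφ₁ :
        AlgebraicClosure (baseFld p₁ φ₁ hφ₁) ≃ₐ[baseFld p₁ φ₁ hφ₁] Fbar ℚ_[p₁]) :
          AlgebraicClosure (baseFld p₁ φ₁ hφ₁) →* Fbar ℚ_[p₁])
      ((((galoisChartRel φ₁ hφ₁ d₁.relTop (d₁.relTop_base_eq φ₁ hφ₁ hd₁) (d₁.toRelTopFrob.obj ⟨cQ (N k), cls⟩)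
          hA₁).muModel n hμ₁).toMulEquiv ζ : rootsOfUnity n (AlgebraicClosure (baseFld p₁ φ₁ hφ₁))) :
        (AlgebraicClosure (baseFld p₁ φ₁ hφ₁))ˣ) =
      ι₁.hom (colimit.ι (cosetSystem N hN ⋙ PadicFrd.bZeroOn d₁.base) k
        (d₁.toB0.app (op (cQ (N k))) (ModelFrobenioid.unit
          (d₁.ofRelTopFrob.map (ζ.val : ObjMonoid d₁.relTop (d₁.toRelTopFrob.obj ⟨cQ (N k), cls⟩)).hom)))) := by
    apply Units.ext
    rw [hleg₁]
    refine (closureEquiv_toClosure_galoisChartRel φ₁ hφ₁ hd₁ ⟨cQ (N k), cls⟩ hA₁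
      (ζ.val : ObjMonoid d₁.relTop (d₁.toRelTopFrob.obj ⟨cQ (N k), cls⟩))).trans ?_
    exact inv_apply_eq_of_coe_eq φ₁ hφ₁ _ _
      ((objRep_spec φ₁ hφ₁ d₁.relTop (d₁.toRelTopFrob.obj ⟨cQ (N k), cls⟩)).trans (hx₁ k).symm)
      (objRep_spec φ₁ hφ₁ d₁.relTop (d₁.toRelTopFrob.obj ⟨cQ (N k), cls⟩)) (SetLike.coe_mem _)
  have h3 := (coe_cast_base_map_alg φ₂ hφ₂ hd₂ (ι.hom.app k).unop
    (@Units.val (d₂.fld (E.obj (cQ (N k)))) _ (d₂.toB0.app (op (E.obj (cQ (N k))))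
      (ΨB.hom.app (op (cQ (N k))) (ModelFrobenioid.unit
        (d₁.ofRelTopFrob.map (ζ.val : ObjMonoid d₁.relTop (d₁.toRelTopFrob.obj ⟨cQ (N k), cls⟩)).hom)))))).trans
    (fieldMap_push_apply_of_reps φ₂ hφ₂ (ι.hom.app k).unop πι hπι (x₂ k) (hx₂ k) xZ hxZ _)
  apply Units.ext
  apply (closureEquiv p₂ φ₂ hφ₂).injective
  rw [MulEquiv.trans_apply, MulDistribMulAction.toMulEquiv_apply, Units.coe_smul,
    ← map_inv (galConjBase p₂ φ₂ hφ₂).symm (toIm φ₂ hφ₂ (baseRep (relTopEquivalence Ψ).functor θ hθo eb)),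
    galConjBase_symm_apply_apply, AlgEquiv.apply_symm_apply, hψn, AlgEquiv.apply_symm_apply, hV, hfac, hlw, hleg₂,
    Subgroup.coe_inv, coe_toIm]
  refine hL.trans (Eq.trans ?_ (congrArg (fun z => (φ₂ (baseRep (relTopEquivalence Ψ).functor θ hθo eb))⁻¹
    ((x₂ k)⁻¹ z)) h3).symm)
  simp only [map_mul, map_inv, AlgEquiv.mul_apply, AlgEquiv.aut_inv, AlgEquiv.symm_apply_apply]
  rfl

include hΨB hN₂ x₁ hx₁ x₂ hx₂ ι₁ ι₂ hlw hleg₁ hleg₂ hfac hψn in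
/-- **The `hO`-square for the context isomorphism `isoOfFunctorRelBasePush`** (abc-iut-L1-t7 gen 6: the object
identification `e_{A₁} := (εF_{A₁})⁻¹` and `compat` DERIVED from a natural isomorphism
`εF : Ψ♭ ⋙ Base₂ ⋙ incl ≅ Base₁ ⋙ incl ⋙ θ_*`) — `hO_of_levelwise` at `eb := baseIsoOfPush …`,
`compat := compat_ofPush …`; the base-point compatibility now reads "`εF⁻¹_{A₁} ≫ η_{A₁}` and `ι_k` have the same point".
[cite: MochizukiFrdII2008, Thm 2.4 (ii) p.21] -/
theorem hO_of_levelwise_basePush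
    (εF : (relTopEquivalence Ψ).functor ⋙ ModelFrobenioid.baseFunctor d₂.relTop.Φ d₂.relTop.B d₂.relTop.divB ⋙
        RelCosetCat.incl (⊤ : OpenSubgroup G₂) ≅
      ModelFrobenioid.baseFunctor d₁.relTop.Φ d₁.relTop.B d₁.relTop.divB ⋙ RelCosetCat.incl (⊤ : OpenSubgroup G₁) ⋙
        CosetCat.push θ hθo)
    (map_H' : H₁.map (isoGOfTheta φ₁ hφ₁ φ₂ hφ₂ (relTopEquivalence Ψ).functor θ hθc hθo hθs hkerθ
      (baseIsoOfPush (relTopEquivalence Ψ).functor θ hθo εF (d₁.toRelTopFrob.obj ⟨cQ (N k), cls⟩))).toMulEquiv.toMonoidHom = H₂)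
    (hpt : CosetCat.pt (εF.inv.app (d₁.toRelTopFrob.obj ⟨cQ (N k), cls⟩) ≫ η.hom.app ⟨cQ (N k), cls⟩) =
      CosetCat.pt (ι.hom.app k).unop) :
    haveI := normal_objL φ₁ hφ₁ d₁.relTop (d₁.toRelTopFrob.obj ⟨cQ (N k), cls⟩) hA₁
    haveI := normal_objL φ₂ hφ₂ d₂.relTop ((relTopEquivalence Ψ).functor.obj (d₁.toRelTopFrob.obj ⟨cQ (N k), cls⟩)) hA₂
    letI := (galoisChartRel φ₁ hφ₁ d₁.relTop (d₁.relTop_base_eq φ₁ hφ₁ hd₁) (d₁.toRelTopFrob.obj ⟨cQ (N k), cls⟩) hA₁).galAction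
    letI := (galoisChartRel φ₂ hφ₂ d₂.relTop (d₂.relTop_base_eq φ₂ hφ₂ hd₂)
      ((relTopEquivalence Ψ).functor.obj (d₁.toRelTopFrob.obj ⟨cQ (N k), cls⟩)) hA₂).galAction
    ∀ ζ : Kummer.Mu n (ObjMonoid d₁.relTop (d₁.toRelTopFrob.obj ⟨cQ (N k), cls⟩)),
      ((((galoisChartRel φ₂ hφ₂ d₂.relTop (d₂.relTop_base_eq φ₂ hφ₂ hd₂)
          ((relTopEquivalence Ψ).functor.obj (d₁.toRelTopFrob.obj ⟨cQ (N k), cls⟩)) hA₂).muModel n hμ₂).toMulEquiv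
        ((isoOfFunctorRelBasePush (hH₁ := hH₁) (hH₂ := hH₂) (d₁.relTop_base_eq φ₁ hφ₁ hd₁) (d₂.relTop_base_eq φ₂ hφ₂ hd₂)
          (relTopEquivalence Ψ).functor hA₁ hA₂ hO θ hθc hθo hθs hkerθ εF map_H').muIso n ζ) :
          rootsOfUnity n (AlgebraicClosure (baseFld p₂ φ₂ hφ₂))) : (AlgebraicClosure (baseFld p₂ φ₂ hφ₂))ˣ) =
      (ψn.trans (MulDistribMulAction.toMulEquiv ((AlgebraicClosure (baseFld p₂ φ₂ hφ₂))ˣ)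
        (((galConjBase p₂ φ₂ hφ₂).symm (toIm φ₂ hφ₂
          (baseRep (relTopEquivalence Ψ).functor θ hθo
            (baseIsoOfPush (relTopEquivalence Ψ).functor θ hθo εF (d₁.toRelTopFrob.obj ⟨cQ (N k), cls⟩)))))⁻¹)))
        ((((galoisChartRel φ₁ hφ₁ d₁.relTop (d₁.relTop_base_eq φ₁ hφ₁ hd₁) (d₁.toRelTopFrob.obj ⟨cQ (N k), cls⟩)
            hA₁).muModel n hμ₁).toMulEquiv ζ : rootsOfUnity n (AlgebraicClosure (baseFld p₁ φ₁ hφ₁))) :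
          (AlgebraicClosure (baseFld p₁ φ₁ hφ₁))ˣ) :=
  hO_of_levelwise φ₁ hφ₁ φ₂ hφ₂ hd₁ hd₂ Ψ E η ΨB hΨB N hN N₂ hN₂ k ι ec x₁ hx₁ x₂ hx₂ ι₁ ι₂ ψbar hlw hleg₁ hleg₂ hfac ψn
    hψn cls hA₁ hA₂ hO θ hθc hθo hθs hkerθ
    (baseIsoOfPush (relTopEquivalence Ψ).functor θ hθo εF (d₁.toRelTopFrob.obj ⟨cQ (N k), cls⟩))
    (compat_ofPush (relTopEquivalence Ψ).functor θ hθo εF (d₁.toRelTopFrob.obj ⟨cQ (N k), cls⟩)) map_H' n hμ₁ hμ₂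
    hpt

end PadicKummer.Def22Context

end Literature.AlgebraicGeometry.Frobenioids

end
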